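import Summits.CriticalPhenomena.PercolationContinuityZ3.Theorems.Transplant.SkelFrmBParamsFaceBandA
import Summits.CriticalPhenomena.PercolationContinuityZ3.Theorems.Transplant.SkelNegBParamsFaceBandA2
import HarnessLib

/-!
# N2 (frames-only node `SamePDropOfSkeletonFrm₁`, OPEN) params column over `PlanarSkeletonFrm` — (ζ″) ledger, shape (B′) of record ((R-14)):
# MECHANICAL PORT of N1's `SkelNegBParamsFaceBandA2` — (ζ′) chain, part FaceBandA2: THE CONTACT BAND ROOM AT THE FACE-APRON REACH `Rl ≤ 2·RA′` (hp-8 g36's located (iii),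
# lane INBOX 2026-08-22T07:57:42Z (3): the provider layer reads `kE := (prFA).kFF₂ fcellsA (E − 1) du.1` with `E := RlevA + reachA`, i.e. `Rl = RlevA + reachA − 1 = RA′ − 2
# + reachA`, … (N1 title abridged; see `SkelNegBParamsFaceBandA2`)
builds on p205010 (kernel theorem, internal audit signed; external expert review pending) — nothing in this file uses p205010; NOTHING is claimed about the
open node `SamePDropOfSkeletonFrm₁` (`SamePDropOfSkeletonNeg₁` is CLOSED in the tree and untouched by this file).
Status sentence (coordinator 2026-08-20T04:30Z): "θ(p_c) = 0 on ℤ^d, all d ≥ 2 — kernel-verified (Lean 4/Mathlib, standard axioms); internal adversarial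
audit SIGNED 2026-08-20 04:29Z; external expert review pending."
Lane `prim-bschramm-*`, seat `prim-bschramm-p1` (gen 17; (F) value layer, lead g11 06:35:07Z) running stmt-g19's port tool of record; helper file (`--supports stmt-CriticalPhenomena-4575 --as helper`); ledger HOME/prim-bschramm-stmt/FRM-PARAMS.md §9, (R-14).
PORT RULES (HOME/prim-bschramm-stmt-g19/lean/port_frm.py, the tool of record per (R-14)): outer namespace `PlanarSkeletonNeg ↦ PlanarSkeletonFrm`, carrier binder
`(Φ : PlanarSkeletonFrm G)`, record binder `(D : Skelφ.StepI.DataNS V)` (the selectors travel IN the record, `SkelPhiStepIDataNS`); section variables INLINED into every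
declaration header; inner namespaces (`Neg`/`NegB`/`KS`/…) and every short name KEPT so all cross-references resolve unchanged; declarations using no section variable are
NOT re-declared (N1's originals are referenced fully qualified). Mathematical content, proofs, docstrings and citations are N1's, verbatim, except where stated next.
SELECTORS IN THIS FILE ((R-14) condition of record — joint selection, `D.sN`'s first argument is the literal handed to `D.sM`): none (pure port; the pairs are read through their N1 names).
N1 HEADER (kept for the reader):
helper file (`--supports stmt-CriticalPhenomena-4575 --as helper`); slot-ledger ζ′ v1.
* **`hkE_RA2`** (`Rl ≤ 2·RA′`), `apronRl_le` (`RlevA + reachA − 1 ≤ 2·RA′`), **`hkE_apron_RA`** (at `Rl := RlevA mk + reachA mk − 1`).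
[cite: KozmaNitzan2024, §4 Lemma 10 Step IV (pp. 20–21); Lemma 12 (pp. 23–25)] [cite: MartineauTassion2017, §4.3]
-/

noncomputable section

open scoped Classical

namespace Summit.CriticalPhenomena.PercolationContinuityZ3.Theorems.Transplant

namespace PlanarSkeletonFrm

namespace NegB

open Literature.Probability.Percolation Literature.Probability.LatticeModels SimpleGraph
open Literature.Probability.Percolation.KozmaNitzan.Cells (oth)
open SkelConc (Consts)
open Skelφ.StepI (DataN)
open Neg

section Band2

/-- **THE CONTACT BAND ROOMS AT `Rl ≤ 2·RA′`** (`g := gT`, both axes, `u_JA = s_J`): `kFF₂ + 8·u_JA + 9 ≤ 5·r_J` and `2·kFF₂ + 8·u_JA + 8 ≤ 5·r_J`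
(from `kFF₂ ≤ 2r + 5Rl + 15`, `10·RA′ < 2·u_JA`, `40·u_JA ≤ r_J`). [cite: KozmaNitzan2024, §4 Lemma 12 (pp. 23–25)] -/
theorem hkE_RA2 (κ : Consts) {V : Type} [DecidableEq V] [Countable V] {G : SimpleGraph V} [G.LocallyFinite] (Φ : PlanarSkeletonFrm G) (t : V) (p : unitInterval) (D : Skelφ.StepI.DataNS V) (f : ℕ) (mk : ℕ) (gx : Neg.FSlot) (hN : EqNumL κ Φ t p D (KS.gT mk gx κ Φ t p D) f) (hκ : (hL κ Φ t p D (KS.gT mk gx κ Φ t p D) f).natAbs ≤ 10 * nL κ Φ t p D (KS.gT mk gx κ Φ t p D) f)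
    {Rl : ℕ} (hRl : Rl ≤ 2 * KS.RA' κ Φ t p D mk) (I : Fin 2) :
    (prFA κ Φ t p D (KS.gT mk gx κ Φ t p D) f).kFF₂ (fcellsA κ Φ t p D (KS.gT mk gx κ Φ t p D) f) Rl I +
          8 * (if oth I = 0 then KS.u₀A κ Φ t p D (KS.gT mk gx κ Φ t p D) f else KS.u₁A κ Φ t p D (KS.gT mk gx κ Φ t p D) f) + 9 ≤
        5 * ((fcellsA κ Φ t p D (KS.gT mk gx κ Φ t p D) f).r (oth I) : ℤ) ∧
      2 * (prFA κ Φ t p D (KS.gT mk gx κ Φ t p D) f).kFF₂ (fcellsA κ Φ t p D (KS.gT mk gx κ Φ t p D) f) Rl I +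
          8 * (if oth I = 0 then KS.u₀A κ Φ t p D (KS.gT mk gx κ Φ t p D) f else KS.u₁A κ Φ t p D (KS.gT mk gx κ Φ t p D) f) + 8 ≤
        5 * ((fcellsA κ Φ t p D (KS.gT mk gx κ Φ t p D) f).r (oth I) : ℤ) := by
  have hq := kFF₂_le_linA κ Φ t p D f mk gx hN hκ Rl I
  obtain ⟨-, hu, hru⟩ := uA_oth_facts κ Φ t p D f mk gx hN hκ I
  have hRl' : (Rl : ℤ) ≤ 2 * KS.RA' κ Φ t p D mk := by exact_mod_cast hRl
  have hR0 : (0 : ℤ) ≤ (Rl : ℤ) := Nat.cast_nonneg _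
  set q := (prFA κ Φ t p D (KS.gT mk gx κ Φ t p D) f).kFF₂ (fcellsA κ Φ t p D (KS.gT mk gx κ Φ t p D) f) Rl I
  set u := (if oth I = 0 then KS.u₀A κ Φ t p D (KS.gT mk gx κ Φ t p D) f else KS.u₁A κ Φ t p D (KS.gT mk gx κ Φ t p D) f)
  set r := ((fcellsA κ Φ t p D (KS.gT mk gx κ Φ t p D) f).r (oth I) : ℤ)
  constructor <;> linarith

/-- **The face-apron reach is at most `2·RA′`**: `RlevA + reachA − 1 ≤ 2·RA′` (`RA′ = RlevA + 1`, `RlevA = j₁A + reachA ≥ reachA`). [folklore] -/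
theorem apronRl_le (κ : Consts) {V : Type} [Countable V] {G : SimpleGraph V} [G.LocallyFinite] (Φ : PlanarSkeletonFrm G) (t : V) (p : unitInterval) (D : Skelφ.StepI.DataNS V) (mk : ℕ) : KS.RlevA κ Φ t p D mk + KS.reachA t D mk - 1 ≤ 2 * KS.RA' κ Φ t p D mk := by
  have h := KS.RA'_eq κ Φ t p D mk
  unfold KS.RlevA at h ⊢
  omega

/-- **THE CONTACT BAND ROOMS AT THE PROVIDER'S `kE`** (`Rl := RlevA + reachA − 1`, hp-8 g36's `kE := kFF₂ … (E − 1) du.1`, `E := RlevA + reachA`):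
`kFF₂ + 8·u_JA + 9 ≤ 5·r_J` and `2·kFF₂ + 8·u_JA + 8 ≤ 5·r_J`. [cite: KozmaNitzan2024, §4 Lemma 12 (pp. 23–25)] -/
theorem hkE_apron_RA (κ : Consts) {V : Type} [DecidableEq V] [Countable V] {G : SimpleGraph V} [G.LocallyFinite] (Φ : PlanarSkeletonFrm G) (t : V) (p : unitInterval) (D : Skelφ.StepI.DataNS V) (f : ℕ) (mk : ℕ) (gx : Neg.FSlot) (hN : EqNumL κ Φ t p D (KS.gT mk gx κ Φ t p D) f) (hκ : (hL κ Φ t p D (KS.gT mk gx κ Φ t p D) f).natAbs ≤ 10 * nL κ Φ t p D (KS.gT mk gx κ Φ t p D) f)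
    (I : Fin 2) :
    (prFA κ Φ t p D (KS.gT mk gx κ Φ t p D) f).kFF₂ (fcellsA κ Φ t p D (KS.gT mk gx κ Φ t p D) f) (KS.RlevA κ Φ t p D mk + KS.reachA t D mk - 1) I +
          8 * (if oth I = 0 then KS.u₀A κ Φ t p D (KS.gT mk gx κ Φ t p D) f else KS.u₁A κ Φ t p D (KS.gT mk gx κ Φ t p D) f) + 9 ≤
        5 * ((fcellsA κ Φ t p D (KS.gT mk gx κ Φ t p D) f).r (oth I) : ℤ) ∧
      2 * (prFA κ Φ t p D (KS.gT mk gx κ Φ t p D) f).kFF₂ (fcellsA κ Φ t p D (KS.gT mk gx κ Φ t p D) f) (KS.RlevA κ Φ t p D mk + KS.reachA t D mk - 1) I +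
          8 * (if oth I = 0 then KS.u₀A κ Φ t p D (KS.gT mk gx κ Φ t p D) f else KS.u₁A κ Φ t p D (KS.gT mk gx κ Φ t p D) f) + 8 ≤
        5 * ((fcellsA κ Φ t p D (KS.gT mk gx κ Φ t p D) f).r (oth I) : ℤ) :=
  hkE_RA2 κ Φ t p D f mk gx hN hκ (apronRl_le κ Φ t p D mk) I

end Band2

end NegB

end PlanarSkeletonFrm

end Summit.CriticalPhenomena.PercolationContinuityZ3.Theorems.Transplant

end
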